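import Mathlib
import HarnessLib.Audit
import Summits.PneNP.PneNP.Theorems.PstarGateNodesX
import Summits.PneNP.PneNP.Theorems.PstarGateCaseT

/-!
# One GATED chord, CASE T: on the gate chamber's OFF region the untouched constraint is pinned (E2; prover-1 g19)

FRONTIER range-avoidance ladder, rung F-N3 (`stmt-PneNP-19007`), cell `pnp-ideate` (`PstarGateNodesX`, nodes N3/N4); restricted-model proof
complexity — nothing here bears on `P` versus `NP`.

CASE T: the other chords read along one transverse direction `mv ∈ {(0,1),(1,1)}` and are read; one gate of coefficient `κ₀ + x_u`.  Wherever the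
gated chord is OFF on the gate chamber (`x_u = κ₀ + 1`, `u_e(x) = 0`), every other chord is ON (`PstarGateCaseT.caseT_forced`) and the basis-changed
first coordinate misses its target by one (`PstarGateCaseT.caseT_fst`).  Unwinding the basis change `toX mv` (whose first coordinate is the original
SECOND coordinate, as `partner mv = (1,0)`):

* `caseT_off_q` — **`q_{(1,0)}(x) = 1 + σ(x)`** with `σ(x) = Σ_{i ∈ N − e} ((ρ_i x)₂ + (ρ'_i x)₂)`, the number (mod 2) of private reads of the other
  chords — the CASE T analogue of `PstarGateU2Off.u2_off`.
-/

set_option linter.dupNamespace false -- `Summit.PneNP.PneNP.…`: summit = sub-problem name (D-0017 single-conjunct layout)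

open Finset Literature.Computability.Complexity
open Summit.PneNP.PneNP.Theorems.PstarTyped (Typed)
open Summit.PneNP.PneNP.Theorems.PstarReadSumset (V2)
open Summit.PneNP.PneNP.Theorems.PstarChordSystem (ChordSystem)
open Summit.PneNP.PneNP.Theorems.PstarChordSystemMap (mapSys toX omega partner mapSys_u mapSys_ρ mapSys_ρ' mapSys_F mapSys_t)
open Summit.PneNP.PneNP.Theorems.PstarChordBridgeTools (privs coef)
open Summit.PneNP.PneNP.Theorems.PstarChordBridge (BridgeData sys Solution Lift)
open Summit.PneNP.PneNP.Theorems.PstarChordBridgeBasis (qDir)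
open Summit.PneNP.PneNP.Theorems.PstarGateBridge (GateHyp)
open Summit.PneNP.PneNP.Theorems.PstarGateCaseT (caseT_forced caseT_fst)
open Summit.PneNP.PneNP.Theorems.PstarGateNodes (GateData)
open Summit.PneNP.PneNP.Theorems.PstarGateNodesX (GateDataX)

namespace Summit.PneNP.PneNP.Theorems.PstarGateCaseTOffQ

variable {n m : ℕ}

/-- The first coordinate of `toX mv` for a transverse `mv` is the original second coordinate. -/
theorem toX_fst_of_T {mv : V2} (hmvT : mv = (0, 1) ∨ mv = (1, 1)) (v : V2) : (toX mv v).1 = v.2 := by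
  show omega v (partner mv) = v.2
  unfold partner omega
  rcases hmvT with rfl | rfl <;> simp

/-- **CASE T, OFF region of the gate chamber: `q_{(1,0)} = 1 + σ`.** -/
theorem caseT_off_q (I : LocalMap 4 n m) (hI : I.IsPure xorAndPred) (hT : Typed I) {r₀ : ℕ} {B : BridgeData n m} {e g₀ : Fin m}
    {u : Fin n} {κ₀ : ZMod 2} (hD : GateDataX I r₀ B e g₀ u κ₀) {mv : V2} (hmvT : mv = (0, 1) ∨ mv = (1, 1))
    (hP : ∀ e' ∈ B.N, e' ≠ e → ∀ a, ((sys I B).ρ e' a = 0 ∨ (sys I B).ρ e' a = mv) ∧ ((sys I B).ρ' e' a = 0 ∨ (sys I B).ρ' e' a = mv))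
    (hread : ∀ e' ∈ B.N, e' ≠ e → ∀ a, (sys I B).ρ e' a ≠ 0 ∨ (sys I B).ρ' e' a ≠ 0)
    {x : Fin n → ZMod 2} (hxu : x u = κ₀ + 1) (hue : (sys I B).u e x = 0) :
    qDir I B (1, 0) x = 1 + ∑ i ∈ B.N.erase e, (((sys I B).ρ i x).2 + ((sys I B).ρ' i x).2) := by
  classical
  obtain ⟨-, hW, -, -, -, hL, -, -, hG, -, -, -, -, -, -, hcoef, hT3, -⟩ := id hD
  have he : e ∈ B.N := hG.1
  have hc1 : coef I B.C₁ B.G₁ (I.vars e 2) x = 1 := by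
    rw [hcoef, hxu]
    have e2 : ∀ k : ZMod 2, k + (k + 1) = 1 := by decide
    exact e2 κ₀
  have hx : ((sys I B).u e x = 0 ∧ coef I B.C₁ B.G₁ (I.vars e 2) x = 1) ∨
      qDir I B mv x + (sys I B).u e x * coef I B.C₁ B.G₁ (I.vars e 2) x = 0 := Or.inl ⟨hue, hc1⟩
  have hon := caseT_forced I hI hT hW hL hG hT3 hmvT hP hread hx
  have hfst := caseT_fst I hI hT hW hL hG hT3 hmvT hP hx
  -- the ON chords are exactly `N − e`
  have hfilter : B.N.filter (fun i => ¬ (sys I B).u i x = 0) = B.N.erase e := by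
    ext i
    simp only [mem_filter, mem_erase]
    constructor
    · rintro ⟨hi, hui⟩
      exact ⟨fun h => hui (h ▸ hue), hi⟩
    · rintro ⟨hne, hi⟩
      refine ⟨hi, ?_⟩
      rw [PstarChordBridgeForcing.sys_u_eq, hon i hi hne]
      have e2 : ∀ g : ZMod 2, g + (g + 1) ≠ 0 := by decide
      exact e2 _
  rw [hfilter] at hfst
  simp only [mapSys_F, mapSys_ρ, mapSys_ρ', mapSys_t, ← map_add, toX_fst_of_T hmvT, Prod.snd_add] at hfst
  unfold PstarChordBridgeBasis.qDir
  simp only [zero_mul, one_mul, zero_add]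
  have e3 : ∀ F s t : ZMod 2, F + s = t + 1 → F + t = 1 + s := by decide
  exact e3 _ _ _ hfst

end Summit.PneNP.PneNP.Theorems.PstarGateCaseTOffQ
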